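import Summits.Ventures.YMGap.Census.DecimationLowerBound
import Summits.Ventures.YMGap.Census.ZplusLowerBound
import HarnessLib

/-!
# Venture YMGap, track (b) census — Tomboulis IV.4 (the LOWER bound for `Z⁺`, (4.13)) on even tori, where the tree's (4.10) exponent allows

HONEST FRAMING: venture file of the cell `pub-ymgap` (QuantumFields programme).  Exact statements about the finite tori
`(ℤ/bLℤ)^d → (ℤ/Lℤ)^d`, twist on Tomboulis's sheet `𝒱_{ij}` on both; nothing about (5.15), confinement or any limit.

Tomboulis (arXiv:0707.2179, Prop. IV.4, eq. (4.13); proof App. A §3, "Similarly, from (lessplaq), IV.2(ii) and using (Z>Z-)"):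
`Z⁺_{Λ^{(n)}}({c_j(n-1)^6}) ≤ Z⁺_{Λ^{(n-1)}}({c_j(n-1)})`.  Exactly as for III.2 (`DecimationLowerBound`): IV.2 (ii) on the FINE torus with an
exponent at least the number of coarse plaquettes, then the sup bound `|f(±U)| ≤ 1 + Σ_j d_j² c_j` on the coarse torus.  The tree certifies
IV.2 (ii) with exponent `(side)^d/4` (`torusZplus_lowerBound_quarter`, even side, `d ≥ 3`), so IV.4 is a tree theorem whenever
`4 · #plaquettes((ℤ/Lℤ)^d) ≤ (bL)^d`, i.e. `2d(d-1) ≤ b^d` (every `b ≥ 3` in `d = 3, 4`; `b = 2` from `d = 6` on); `b = 2` in `d = 3, 4, 5` is NOT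
covered.  `abs_plaqFnTwist_le`, `torusZtw_le_pow_card`, `torusZplus_le_pow_card` (sup bounds); `decimationLowerBoundPlus_of_four_mul_card_le`,
`decimationLowerBoundPlus_of_le`, instances `decimationLowerBoundPlus_three_d3` / `_d4`.
[cite: Tomboulis2007Confinement, Prop. IV.4 eq. (4.13); App. A §3]
-/

noncomputable section

open MeasureTheory Finset Real
open scoped BigOperators
open Literature.MathematicalPhysics.QuantumLattice
open Literature.MathematicalPhysics.QuantumFieldTheory
open Literature.MathematicalPhysics.QuantumFieldTheory.Tomboulis2007

namespace Summit.Ventures.YMGap.Census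

variable {d L : ℕ} [NeZero L]

/-- `|f(-U)| ≤ 1 + Σ_j d_j² c_j` for `c_j ≥ 0`. [folklore] -/
theorem abs_plaqFnTwist_le (J : ℕ) {c : ℕ → ℝ} (hc : ∀ n, 1 ≤ n → 0 ≤ c n) (g : SU2) :
    |plaqFnTwist J c g| ≤ 1 + ∑ n ∈ Icc 1 J, ((n : ℝ) + 1) ^ 2 * c n := by
  rw [← plaqFn_negOne_mul]
  exact abs_plaqFn_le J hc _

/-- **Sup bound for the twisted partition function**: `Z⁻_Λ({c_j}; V) ≤ [1 + Σ_j d_j² c_j]^{#plaquettes}` for `c_j ≥ 0`, any `V`. [folklore] -/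
theorem torusZtw_le_pow_card (J : ℕ) {c : ℕ → ℝ} (hc : ∀ n, 1 ≤ n → 0 ≤ c n) (V : Finset (Plaquette d L)) :
    torusZtw d L J c V ≤ (1 + ∑ n ∈ Icc 1 J, ((n : ℝ) + 1) ^ 2 * c n) ^ Fintype.card (Plaquette d L) := by
  unfold torusZtw
  refine (le_abs_self _).trans ?_
  have h := norm_integral_le_of_norm_le_const (μ := Measure.pi fun _ : Edge d L => haarProbability SU2)
    (f := fun U : Edge d L → SU2 => ∏ p : Plaquette d L,
      (if p ∈ V then plaqFnTwist J c (plaquetteHolonomy U p.1 p.2.1.1 p.2.1.2)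
        else plaqFn J c (plaquetteHolonomy U p.1 p.2.1.1 p.2.1.2)))
    (C := (1 + ∑ n ∈ Icc 1 J, ((n : ℝ) + 1) ^ 2 * c n) ^ Fintype.card (Plaquette d L))
    (Filter.Eventually.of_forall fun U => ?_)
  · simpa using h
  · rw [Real.norm_eq_abs, Finset.abs_prod, ← Finset.card_univ, ← Finset.prod_const]
    refine prod_le_prod (fun _ _ => abs_nonneg _) fun p _ => ?_
    split_ifs
    · exact abs_plaqFnTwist_le J hc _
    · exact abs_plaqFn_le J hc _

/-- **Sup bound for `Z⁺ = (Z + Z⁻)/2`**: `Z⁺_Λ({c_j}; V) ≤ [1 + Σ_j d_j² c_j]^{#plaquettes}` for `c_j ≥ 0`. [folklore] -/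
theorem torusZplus_le_pow_card (J : ℕ) {c : ℕ → ℝ} (hc : ∀ n, 1 ≤ n → 0 ≤ c n) (V : Finset (Plaquette d L)) :
    torusZplus d L J c V ≤ (1 + ∑ n ∈ Icc 1 J, ((n : ℝ) + 1) ^ 2 * c n) ^ Fintype.card (Plaquette d L) := by
  have h1 := torusZ_le_pow_card (d := d) (L := L) J hc
  have h2 := torusZtw_le_pow_card (d := d) (L := L) J hc V
  unfold torusZplus
  linarith

/-- **IV.4 on even fine tori, `d ≥ 3`, whenever `4 · #plaquettes((ℤ/Lℤ)^d) ≤ (bL)^d`** — App. A §3 verbatim with the tree's quarter-exponent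
instance of IV.2 (ii) (`torusZplus_lowerBound_quarter`): `Z⁺_{(ℤ/L)^d}({c_j^6}) ≤ Z⁺_{(ℤ/bL)^d}({c_j})` for every admissible `c`, every plane.
[cite: Tomboulis2007Confinement, Prop. IV.4 eq. (4.13); App. A §3] -/
theorem decimationLowerBoundPlus_of_four_mul_card_le (hd : 3 ≤ d) (b J : ℕ) [NeZero (b * L)] (hbL : Even (b * L)) {i j : Fin d}
    (hij : i < j) (hm : 4 * Fintype.card (Plaquette d L) ≤ (b * L) ^ d) {c : ℕ → ℝ} (hc : CoeffAdmissible c) :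
    torusZplus d L J (lowerCoeff c) (vortexSheet L i j hij) ≤ torusZplus d (b * L) J c (vortexSheet (b * L) i j hij) := by
  have hc6 : ∀ n, 1 ≤ n → 0 ≤ lowerCoeff c n := fun n hn => pow_nonneg (hc n hn).1 6
  have hm' : Fintype.card (Plaquette d L) ≤ (b * L) ^ d / 4 := (Nat.le_div_iff_mul_le (by norm_num)).2 (by simpa [mul_comm] using hm)
  calc torusZplus d L J (lowerCoeff c) (vortexSheet L i j hij)
      ≤ (1 + ∑ n ∈ Icc 1 J, ((n : ℝ) + 1) ^ 2 * lowerCoeff c n) ^ Fintype.card (Plaquette d L) := torusZplus_le_pow_card J hc6 _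
    _ = (1 + ∑ n ∈ Icc 1 J, ((n : ℝ) + 1) ^ 2 * c n ^ 6) ^ Fintype.card (Plaquette d L) := rfl
    _ ≤ (1 + ∑ n ∈ Icc 1 J, ((n : ℝ) + 1) ^ 2 * c n ^ 6) ^ ((b * L) ^ d / 4) := pow_le_pow_right₀ (one_le_hypercubeBase J c) hm'
    _ ≤ torusZplus d (b * L) J c (vortexSheet (b * L) i j hij) := torusZplus_lowerBound_quarter hd hbL J hij hc

/-- **IV.4 for `2d(d-1) ≤ b^d`** (every `b ≥ 3` in `d = 3, 4`; `b = 2` needs `d ≥ 6`), fine torus even, every `J`, every plane, every admissible `c`.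
[cite: Tomboulis2007Confinement, Prop. IV.4 eq. (4.13)] -/
theorem decimationLowerBoundPlus_of_le (hd : 3 ≤ d) (b J : ℕ) [NeZero (b * L)] (hbL : Even (b * L)) {i j : Fin d} (hij : i < j)
    (hb : 2 * (d * (d - 1)) ≤ b ^ d) {c : ℕ → ℝ} (hc : CoeffAdmissible c) :
    torusZplus d L J (lowerCoeff c) (vortexSheet L i j hij) ≤ torusZplus d (b * L) J c (vortexSheet (b * L) i j hij) := by
  refine decimationLowerBoundPlus_of_four_mul_card_le hd b J hbL hij ?_ hc
  have h2 := two_mul_card_plaquette (d := d) (L := L)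
  calc 4 * Fintype.card (Plaquette d L) = 2 * (d * (d - 1)) * L ^ d := by rw [show 4 = 2 * 2 from rfl, mul_assoc, h2, ← mul_assoc, ← mul_assoc]
    _ ≤ b ^ d * L ^ d := Nat.mul_le_mul_right _ hb
    _ = (b * L) ^ d := (mul_pow b L d).symm

/-- Instance: **IV.4 holds for `b = 3` in `d = 3` on every even torus, every plane.** [cite: Tomboulis2007Confinement, Prop. IV.4 eq. (4.13)] -/
theorem decimationLowerBoundPlus_three_d3 (hL : Even L) (J : ℕ) {i j : Fin 3} (hij : i < j) {c : ℕ → ℝ} (hc : CoeffAdmissible c) :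
    torusZplus 3 L J (lowerCoeff c) (vortexSheet L i j hij) ≤ torusZplus 3 (3 * L) J c (vortexSheet (3 * L) i j hij) :=
  haveI : NeZero (3 * L) := ⟨by have := NeZero.ne L; omega⟩
  decimationLowerBoundPlus_of_le (le_refl 3) 3 J (hL.mul_left 3) hij (by norm_num) hc

/-- Instance: **IV.4 holds for `b = 3` in `d = 4` on every even torus, every plane.** [cite: Tomboulis2007Confinement, Prop. IV.4 eq. (4.13)] -/
theorem decimationLowerBoundPlus_three_d4 (hL : Even L) (J : ℕ) {i j : Fin 4} (hij : i < j) {c : ℕ → ℝ} (hc : CoeffAdmissible c) :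
    torusZplus 4 L J (lowerCoeff c) (vortexSheet L i j hij) ≤ torusZplus 4 (3 * L) J c (vortexSheet (3 * L) i j hij) :=
  haveI : NeZero (3 * L) := ⟨by have := NeZero.ne L; omega⟩
  decimationLowerBoundPlus_of_le (by norm_num) 3 J (hL.mul_left 3) hij (by norm_num) hc

end Summit.Ventures.YMGap.Census
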